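/-
Copyright (c) 2026 the pub-hodgecm-mathlib formalisation cell (harness21).  Prover seat hodgecm-mathlib-LH3-p02 (g6); dealer LH4-plan (g7) WORD #2 «LAYER B 3∕3 — F1»,
2026-09-02.  Count-neutral base layer of the dyadic (D-UNR) column (FINDINGS #6∕#6′ of the LH4 board); CENSUS-LAYERB-3of3 4277d501 row F1.
-/
import Literature.NumberTheory.Automorphic.UnitaryThreeTorusBlockElements        -- ★ γ2b-A: `exists_coe_eq_block_of_rel`, `exists_diagRadial` (+ ★ γ2a `block_mul_block`, ★ B-p04 block lemmas)
import Literature.NumberTheory.Automorphic.UnitaryThreeDoubleCosetsHKStabilizer   -- ★ `exists_coe_eq_block_of_mem_centralizer`, `v_eq_one_of_coe_eq_block`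
import Literature.NumberTheory.Rogawski1990.FlickerTorusTraceFrame               -- ★ p851724 (T3)∕(T5): `traceTorusEltPi_unitary` (the trace literal is unitary)
import Literature.NumberTheory.LocalFields.NormOneTorusCayleyLevelShift          -- ★ (T0) `valued_eq_one_of_map_mul_self_eq_one`
import HarnessLib

/-!
# Block elements of `U(σ, Φ₃)` in the TRACE frame: the torus `Z_H(t_{π}^{(b)}) = {x·P + y·(1 − P)} × {e}` and its integral eigen-coordinates
# (Flicker 1998, Prop. 6 p. 83 — every residue characteristic; LAYER B 3∕3, file F1 of CENSUS-LAYERB-3of3)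

Topic `NumberTheory/Automorphic`; namespace `Literature.NumberTheory.Automorphic.UnitaryGroup`.  THEOREMS ONLY (no `def`, no instance, no notation, no named fact,
no `sorry`).  Cell `pub/hodgecm-mathlib`, crux H413 = `stmt-HodgeConjecture-24833`; LH4 board (D-UNR) FINDING #6 «LAYER B» (the 2-free re-cut of Flicker's engine):
this is F1 of CENSUS-LAYERB-3of3 (LH3-p02 (g6), sha16 4277d501e16e5836), the trace-frame twin of ★ γ2b-A `UnitaryThreeTorusBlockElements` (the `(A, θ²C; C, A)`-shaped
torus of Flicker's frame, which needs `|2| = 1`).  Read with CENSUS-R1 52a4c879 (LH4-p03 (g8)) and FINDING #6′ (178∕178 numeric certificate).  It feeds F2 (Prop. 6 (a)),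
F3 (Prop. 6 (b)), F4 (Prop. 6 (c)∕7) — the three heads that re-dock ★ (F3a) `FixedPointsTorusDoubleCosetCount` BY NAME; the two COUNT heads
`rankStrata_counts_of_congr_traceTorusElt{Pi,}` stay HYPOTHESES of the G-side until LAYER C lands (census §0.4).

FRAME.  `K` a field with involution `σ`; `U = U(σ, Φ₃)(K)`, `Φ₃ = antidiag(1,1,1)` (`hJ : J = (StdForm.antidiagonal 3).over K`); `c = diag(1,−1,1)`, `H = Z_U(c)` (block
elements `!![α,0,β;0,e,0;γ,0,δ]`); `b ∈ K` with **`b + σb = 1`** (the trace-one element of ★ `UnramifiedLocalConjDatum.trace`); `π, π′` with `ππ′ = 1`, `σπ = π` (`π = 1`: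
the θ̄ = 0 literal; `π = ϖ`: θ̄ = 1).  THE TRACE TORUS BLOCK with eigen-coordinates `(x, e, y)`:

  `M(x, e, y) := !![x·σb + y·b, 0, π·(x − y); 0, e, 0; π′·(b·σb·(x − y)), 0, x·b + y·σb]`

— token for token ★ p851724 (T5) `t_π^{(b)}(a, m, c)` at `(a, m, c) = (x, e, y)` and ★ p851796 :93 `hlit`.  Its corner is `x·P + y·(1 − P)` for the idempotent
`P = (σb, π; π′bσb, b)` (`P² = P` by `b + σb = 1`; `P` is self-adjoint for the `σ`-adjoint of `antidiag(1,1)`), so these matrices MULTIPLY COORDINATEWISE (§2) and the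
centraliser of a regular one (`x₁ ≠ x₃`) inside `H` is exactly the set of all of them (§4).  THE POINT OF THE FILE (census §0.1, §2): the eigen-coordinates are READ OFF THE MATRIX
BY INTEGRAL LINEAR FORMS — `x = M₀₀ + b·π′·M₀₂`, `y = M₀₀ − σb·π′·M₀₂` — with no `½` anywhere (Flicker's torus reads `p = (μ₊ + μ₋)∕2`), which is why Prop. 6 (c)'s weight
`(q+1)q^{2i+ε−1}` survives verbatim at a dyadic place (F4).

* §1 `block_mul_eq_mul_iff_of_ne_zero`, `mem_centralizer_block_iff_of_ne_zero` — commutation of two block elements with a GENERAL corner `(A B; C D)`, `B ≠ 0`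
  (★ γ2a `mem_centralizer_block_iff` is the equal-diagonal case `D = A`).
* §2 `traceTorusBlock_mul` (coordinatewise product), `traceTorusBlock_read_fst ∕ _snd` (the integral eigen-coordinate reading), `det_traceTorusBlock` (`= x·e·y`).
* §3 `exists_coe_eq_traceTorusBlock` (**constructor**: `M(x,e,y) ∈ U` for norm-one `x, e, y` — ★ (T5) `traceTorusEltPi_unitary` CITED through ★ `mem_unitaryGroupOfForm_iff`),
  `traceTorusBlock_mem_centralizer_diag` (`∈ H`), `traceTorusBlock_mem_centralizer` (`∈ Z(t)` for `t = M(x₁, x₂, x₃)`).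
* §4 `exists_coe_eq_traceTorusBlock_of_mem_centralizer` (**shape**: every `τ ∈ Z_H(t)`, `t = M(x₁,x₂,x₃)` regular, IS `M(x, e, y)` with `x, y` read as in §2; `h2 : (2 : K) ≠ 0`
  is the CHARACTERISTIC token behind the block shape of `Z(c)`, ★ `exists_coe_eq_block_of_mem_centralizer` — not `|2| = 1`), `map_mul_self_eq_one_of_coe_eq_traceTorusBlock`
  (the eigen-coordinates of a unitary `M(x,e,y)` are NORM-ONE).
* §5 (valued) `v_eq_one_of_add_map_eq_one` (`|b| = |σb| = 1` from `b + σb = 1`, `|b| ≤ 1` ALONE — every residue characteristic), `v_traceTorusBlock_coord_eq_one`.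
* §6 a comment block for F2's typer: the left-normaliser `C` replacing ★'s `diag(θ, 1)` in the MARS step (paper computation, census §6 (i)).
HONEST LABEL: HC_CM is proved only modulo the printed citations (hLiu418 = `stmt-HodgeConjecture-24832`, h413 = `stmt-HodgeConjecture-24833`) until rung 0 closes; this is
structure theory, it pays no organ and opens no road ((D-UNR) stays PRINT by D74′).

## References
* [Flicker1998UnitaryFL] Y. Z. Flicker, *Elementary proof of the fundamental lemma for a unitary group*, Canad. J. Math. 50 (1998), §2 Prop. 3 pp. 78–79 (the torus
  literal), Prop. 6 p. 83 (`T_H^θ`, its centraliser description), REMARK p. 84.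
* [Rogawski1990] J. D. Rogawski, *Automorphic Representations of Unitary Groups in Three Variables* (1990), §1.9 p. 8 (`Φ₃`, `U(Φ)`), §4.9 p. 55 (`H = U(2) × U(1)`).
* [Serre1979] J.-P. Serre, *Local Fields*, GTM 67, Ch. V §2–§3 (trace∕norm in unramified extensions; norm-one elements are units).
-/

set_option autoImplicit false

open Matrix
open scoped MatrixGroups WithZero

namespace Literature.NumberTheory.Automorphic.UnitaryGroup

variable {K : Type*} [Field K] (σ : K →+* K) {J : Matrix (Fin 3) (Fin 3) K} (hJ : J = (StdForm.antidiagonal 3).over K)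

/-! ## §1 Commutation of block elements with a general regular corner -/

/-- **Two block elements commute iff their corners do**; for a corner `(A B; C D)` with `B ≠ 0` this is the pair of conditions `β·C = B·γ` and `B·(α − δ) = β·(A − D)`
(the third entry condition `γ(A − D) = C(α − δ)` follows).  ★ γ2a `block_mul_eq_mul_iff` is the case `D = A`. [cite: Flicker1998UnitaryFL, Prop. 6 p. 83] -/
theorem block_mul_eq_mul_iff_of_ne_zero {h t : ↥(unitaryGroupOfForm σ J)} {α β γ δ e A B C D m : K}
    (hh : ((h : GL (Fin 3) K) : Matrix (Fin 3) (Fin 3) K) = !![α, 0, β; 0, e, 0; γ, 0, δ])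
    (ht : ((t : GL (Fin 3) K) : Matrix (Fin 3) (Fin 3) K) = !![A, 0, B; 0, m, 0; C, 0, D]) (hB : B ≠ 0) :
    h * t = t * h ↔ β * C = B * γ ∧ B * (α - δ) = β * (A - D) := by
  constructor
  · intro hc
    have hM : ((h : GL (Fin 3) K) : Matrix (Fin 3) (Fin 3) K) * ((t : GL (Fin 3) K) : Matrix (Fin 3) (Fin 3) K) =
        ((t : GL (Fin 3) K) : Matrix (Fin 3) (Fin 3) K) * ((h : GL (Fin 3) K) : Matrix (Fin 3) (Fin 3) K) := by
      rw [← Units.val_mul, ← Units.val_mul, ← Subgroup.coe_mul, ← Subgroup.coe_mul, hc]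
    rw [hh, ht, block_mul_block, block_mul_block] at hM
    have h00 : α * A + β * C = A * α + B * γ := by have e := congrFun (congrFun hM 0) 0; simpa using e
    have h02 : α * B + β * D = A * β + B * δ := by have e := congrFun (congrFun hM 0) 2; simpa using e
    constructor
    · linear_combination h00
    · linear_combination h02
  · rintro ⟨h1, h2⟩
    have h3 : γ * (A - D) = C * (α - δ) := by
      have : B * (γ * (A - D)) = B * (C * (α - δ)) := by linear_combination (D - A) * h1 - C * h2
      exact mul_left_cancel₀ hB this
    have e1 : α * A + β * C = A * α + B * γ := by linear_combination h1
    have e2 : α * B + β * D = A * β + B * δ := by linear_combination h2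
    have e3 : γ * A + δ * C = C * α + D * γ := by linear_combination h3
    have e4 : γ * B + δ * D = C * β + D * δ := by linear_combination (-1 : K) * h1
    apply Subtype.ext; apply Units.ext
    rw [Subgroup.coe_mul, Subgroup.coe_mul, Units.val_mul, Units.val_mul, hh, ht, block_mul_block, block_mul_block, e1, e2, e3, e4, mul_comm e m]

/-- The centraliser form of ★ `block_mul_eq_mul_iff_of_ne_zero`. [cite: Flicker1998UnitaryFL, Prop. 6 p. 83] -/
theorem mem_centralizer_block_iff_of_ne_zero {h t : ↥(unitaryGroupOfForm σ J)} {α β γ δ e A B C D m : K}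
    (hh : ((h : GL (Fin 3) K) : Matrix (Fin 3) (Fin 3) K) = !![α, 0, β; 0, e, 0; γ, 0, δ])
    (ht : ((t : GL (Fin 3) K) : Matrix (Fin 3) (Fin 3) K) = !![A, 0, B; 0, m, 0; C, 0, D]) (hB : B ≠ 0) :
    h ∈ Subgroup.centralizer ({t} : Set ↥(unitaryGroupOfForm σ J)) ↔ β * C = B * γ ∧ B * (α - δ) = β * (A - D) := by
  rw [Subgroup.mem_centralizer_singleton_iff, block_mul_eq_mul_iff_of_ne_zero σ hh ht hB]

/-! ## §2 The trace torus blocks `M(x, e, y)`: product, eigen-coordinate reading, determinant (pure algebra, `b + σb = 1`, `ππ′ = 1`) -/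

/-- **COORDINATEWISE PRODUCT**: `M(x,e,y) · M(x′,e′,y′) = M(xx′, ee′, yy′)` — the corner is `xP + y(1−P)` for the idempotent `P = (σb, π; π′bσb, b)` (`P² = P` by `b + σb = 1`).
[cite: Flicker1998UnitaryFL, Prop. 6 p. 83] -/
theorem traceTorusBlock_mul {b π π' : K} (hb : b + σ b = 1) (hππ : π * π' = 1) (x e y x' e' y' : K) :
    !![x * σ b + y * b, 0, π * (x - y); 0, e, 0; π' * (b * σ b * (x - y)), 0, x * b + y * σ b] *
        !![x' * σ b + y' * b, 0, π * (x' - y'); 0, e', 0; π' * (b * σ b * (x' - y')), 0, x' * b + y' * σ b] =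
      !![x * x' * σ b + y * y' * b, 0, π * (x * x' - y * y'); 0, e * e', 0; π' * (b * σ b * (x * x' - y * y')), 0, x * x' * b + y * y' * σ b] := by
  have e00 : (x * σ b + y * b) * (x' * σ b + y' * b) + π * (x - y) * (π' * (b * σ b * (x' - y'))) = x * x' * σ b + y * y' * b := by
    linear_combination (x * x' * σ b + y * y' * b) * hb + (b * σ b * (x - y) * (x' - y')) * hππ
  have e02 : (x * σ b + y * b) * (π * (x' - y')) + π * (x - y) * (x' * b + y' * σ b) = π * (x * x' - y * y') := by
    linear_combination (π * (x * x' - y * y')) * hb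
  have e20 : π' * (b * σ b * (x - y)) * (x' * σ b + y' * b) + (x * b + y * σ b) * (π' * (b * σ b * (x' - y'))) =
      π' * (b * σ b * (x * x' - y * y')) := by
    linear_combination (π' * (b * σ b) * (x * x' - y * y')) * hb
  have e22 : π' * (b * σ b * (x - y)) * (π * (x' - y')) + (x * b + y * σ b) * (x' * b + y' * σ b) = x * x' * b + y * y' * σ b := by
    linear_combination (x * x' * b + y * y' * σ b) * hb + (b * σ b * (x - y) * (x' - y')) * hππ
  rw [block_mul_block, e00, e02, e20, e22]

/-- **EIGEN-COORDINATE READING, first**: `x = M₀₀ + b·π′·M₀₂` — an INTEGRAL LINEAR form in the entries (no `½`). [cite: Flicker1998UnitaryFL, Prop. 6 p. 83] -/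
theorem traceTorusBlock_read_fst {b π π' : K} (hb : b + σ b = 1) (hππ : π * π' = 1) (x y : K) :
    (x * σ b + y * b) + b * π' * (π * (x - y)) = x := by
  linear_combination x * hb + (b * x - b * y) * hππ

/-- **EIGEN-COORDINATE READING, second**: `y = M₀₀ − σb·π′·M₀₂`. [cite: Flicker1998UnitaryFL, Prop. 6 p. 83] -/
theorem traceTorusBlock_read_snd {b π π' : K} (hb : b + σ b = 1) (hππ : π * π' = 1) (x y : K) :
    (x * σ b + y * b) - σ b * π' * (π * (x - y)) = y := by
  linear_combination y * hb - (σ b * x - σ b * y) * hππ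

/-- **DETERMINANT**: `det M(x,e,y) = x·e·y`. [cite: Flicker1998UnitaryFL, Prop. 6 p. 83] -/
theorem det_traceTorusBlock {b π π' : K} (hb : b + σ b = 1) (hππ : π * π' = 1) (x e y : K) :
    (!![x * σ b + y * b, 0, π * (x - y); 0, e, 0; π' * (b * σ b * (x - y)), 0, x * b + y * σ b] : Matrix (Fin 3) (Fin 3) K).det = x * e * y := by
  rw [Matrix.det_fin_three]
  simp
  have hb' : σ b = 1 - b := by linear_combination hb
  rw [hb']
  linear_combination (-(e * b - e * b ^ 2) * (x - y) ^ 2) * hππ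

/-! ## §3 Constructor: `M(x, e, y) ∈ U(σ, Φ₃)`, `∈ H`, `∈ Z(t)` -/

omit hJ in
/-- The tree's two spellings of `Φ₃` agree: `(StdForm.antidiagonal 3).over K` is the matrix `(i, j) ↦ [i + j + 1 = 3]` of ★ p851724. [cite: Rogawski1990, §1.9 p. 8] -/
theorem antidiagonal_three_over_eq_of :
    (StdForm.antidiagonal 3).over K = Matrix.of fun i j : Fin 3 => if i.val + j.val + 1 = 3 then (1 : K) else 0 := by
  ext i j
  fin_cases i <;> fin_cases j <;> simp [StdForm.over, StdForm.antidiagonal]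

include hJ in
/-- **CONSTRUCTOR — the trace torus block is unitary**: for `σσ = id`, `b + σb = 1`, `ππ′ = 1`, `σπ = π`, `σπ′ = π′` and NORM-ONE `x, e, y` the matrix
`M(x,e,y) = !![xσb + yb, 0, π(x−y); 0, e, 0; π′(bσb(x−y)), 0, xb + yσb]` is an element of `U(σ, Φ₃)` — ★ p851724 (T5) `traceTorusEltPi_unitary` read through ★
`mem_unitaryGroupOfForm_iff`; no `2e = 1`, no `|2| = 1`. [cite: Flicker1998UnitaryFL, §2 Prop. 3 pp. 78–79; Prop. 6 p. 83] -/
theorem exists_coe_eq_traceTorusBlock (hσσ : ∀ z, σ (σ z) = z) {b π π' : K} (hb : b + σ b = 1) (hππ : π * π' = 1) (hσπ : σ π = π) (hσπ' : σ π' = π')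
    {x e y : K} (hx : σ x * x = 1) (he : σ e * e = 1) (hy : σ y * y = 1) :
    ∃ τ : ↥(unitaryGroupOfForm σ J), ((τ : GL (Fin 3) K) : Matrix (Fin 3) (Fin 3) K) =
      !![x * σ b + y * b, 0, π * (x - y); 0, e, 0; π' * (b * σ b * (x - y)), 0, x * b + y * σ b] := by
  have hx0 : x ≠ 0 := fun h0 => by rw [h0, mul_zero] at hx; exact zero_ne_one hx
  have he0 : e ≠ 0 := fun h0 => by rw [h0, mul_zero] at he; exact zero_ne_one he
  have hy0 : y ≠ 0 := fun h0 => by rw [h0, mul_zero] at hy; exact zero_ne_one hy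
  have hdet : (!![x * σ b + y * b, 0, π * (x - y); 0, e, 0; π' * (b * σ b * (x - y)), 0, x * b + y * σ b] :
      Matrix (Fin 3) (Fin 3) K).det ≠ 0 := by
    rw [det_traceTorusBlock σ hb hππ]; exact mul_ne_zero (mul_ne_zero hx0 he0) hy0
  have hmem : Matrix.GeneralLinearGroup.mkOfDetNeZero _ hdet ∈ unitaryGroupOfForm σ J := by
    rw [mem_unitaryGroupOfForm_iff, Matrix.GeneralLinearGroup.val_mkOfDetNeZero, hJ, antidiagonal_three_over_eq_of]
    exact Literature.NumberTheory.Rogawski1990.traceTorusEltPi_unitary σ hσσ hb hππ hσπ hσπ' hx he hy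
  exact ⟨⟨_, hmem⟩, Matrix.GeneralLinearGroup.val_mkOfDetNeZero _ _⟩

/-- **`M(x,e,y) ∈ H = Z_U(diag(1,−1,1))`** (block shape; ★ `mem_centralizer_of_coe_eq_block`). [cite: Flicker1998UnitaryFL, §2 p. 78] -/
theorem traceTorusBlock_mem_centralizer_diag {c τ : ↥(unitaryGroupOfForm σ J)}
    (hc : ((c : GL (Fin 3) K) : Matrix (Fin 3) (Fin 3) K) = !![1, 0, 0; 0, -1, 0; 0, 0, 1]) {b π π' x e y : K}
    (hτ : ((τ : GL (Fin 3) K) : Matrix (Fin 3) (Fin 3) K) =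
      !![x * σ b + y * b, 0, π * (x - y); 0, e, 0; π' * (b * σ b * (x - y)), 0, x * b + y * σ b]) :
    τ ∈ Subgroup.centralizer ({c} : Set ↥(unitaryGroupOfForm σ J)) :=
  mem_centralizer_of_coe_eq_block σ hc hτ

/-- **`M(x,e,y) ∈ Z(t)` for `t = M(x₁,x₂,x₃)`** (same `b, π, π′`): both products are `M(xx₁, ex₂, yx₃)` by ★ `traceTorusBlock_mul`. [cite: Flicker1998UnitaryFL, Prop. 6 p. 83] -/
theorem traceTorusBlock_mem_centralizer {t τ : ↥(unitaryGroupOfForm σ J)} {b π π' : K} (hb : b + σ b = 1) (hππ : π * π' = 1) {x₁ x₂ x₃ x e y : K}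
    (ht : ((t : GL (Fin 3) K) : Matrix (Fin 3) (Fin 3) K) =
      !![x₁ * σ b + x₃ * b, 0, π * (x₁ - x₃); 0, x₂, 0; π' * (b * σ b * (x₁ - x₃)), 0, x₁ * b + x₃ * σ b])
    (hτ : ((τ : GL (Fin 3) K) : Matrix (Fin 3) (Fin 3) K) =
      !![x * σ b + y * b, 0, π * (x - y); 0, e, 0; π' * (b * σ b * (x - y)), 0, x * b + y * σ b]) :
    τ ∈ Subgroup.centralizer ({t} : Set ↥(unitaryGroupOfForm σ J)) := by
  rw [Subgroup.mem_centralizer_singleton_iff]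
  apply Subtype.ext; apply Units.ext
  rw [Subgroup.coe_mul, Subgroup.coe_mul, Units.val_mul, Units.val_mul, ht, hτ, traceTorusBlock_mul σ hb hππ, traceTorusBlock_mul σ hb hππ,
    mul_comm x₁ x, mul_comm x₃ y, mul_comm x₂ e]

/-! ## §4 Shape: every element of `Z_H(t)` is a trace torus block; its eigen-coordinates are norm-one -/

/-- **SHAPE OF `Z_H(t)`** for a REGULAR trace literal `t = M(x₁,x₂,x₃)` (`x₁ ≠ x₃`, `ππ′ = 1`, `b + σb = 1`): every `τ ∈ H` commuting with `t` is `M(x, e, y)` with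
`x = τ₀₀ + b·π′·τ₀₂`, `y = τ₀₀ − σb·π′·τ₀₂`, `e = τ₁₁` — the commutant of the regular corner `x₁P + x₃(1−P)` is `span{P, 1−P}`.  `h2 : (2 : K) ≠ 0` is the characteristic
token behind the block shape of `Z(diag(1,−1,1))` (★ `exists_coe_eq_block_of_mem_centralizer`), free for every number-field completion. [cite: Flicker1998UnitaryFL, Prop. 6 p. 83] -/
theorem exists_coe_eq_traceTorusBlock_of_mem_centralizer (h2 : (2 : K) ≠ 0) {c t τ : ↥(unitaryGroupOfForm σ J)}
    (hc : ((c : GL (Fin 3) K) : Matrix (Fin 3) (Fin 3) K) = !![1, 0, 0; 0, -1, 0; 0, 0, 1]) {b π π' : K} (hb : b + σ b = 1) (hππ : π * π' = 1)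
    {x₁ x₂ x₃ : K} (hx : x₁ ≠ x₃)
    (ht : ((t : GL (Fin 3) K) : Matrix (Fin 3) (Fin 3) K) =
      !![x₁ * σ b + x₃ * b, 0, π * (x₁ - x₃); 0, x₂, 0; π' * (b * σ b * (x₁ - x₃)), 0, x₁ * b + x₃ * σ b])
    (hτH : τ ∈ Subgroup.centralizer ({c} : Set ↥(unitaryGroupOfForm σ J))) (hτt : τ ∈ Subgroup.centralizer ({t} : Set ↥(unitaryGroupOfForm σ J))) :
    ∃ x e y : K, ((τ : GL (Fin 3) K) : Matrix (Fin 3) (Fin 3) K) =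
        !![x * σ b + y * b, 0, π * (x - y); 0, e, 0; π' * (b * σ b * (x - y)), 0, x * b + y * σ b] ∧
      x = ((τ : GL (Fin 3) K) : Matrix (Fin 3) (Fin 3) K) 0 0 + b * π' * ((τ : GL (Fin 3) K) : Matrix (Fin 3) (Fin 3) K) 0 2 ∧
      y = ((τ : GL (Fin 3) K) : Matrix (Fin 3) (Fin 3) K) 0 0 - σ b * π' * ((τ : GL (Fin 3) K) : Matrix (Fin 3) (Fin 3) K) 0 2 ∧
      e = ((τ : GL (Fin 3) K) : Matrix (Fin 3) (Fin 3) K) 1 1 := by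
  obtain ⟨α, β, γ, δ, e, hτ⟩ := exists_coe_eq_block_of_mem_centralizer σ h2 hc hτH
  have hπ0 : π ≠ 0 := fun h0 => by rw [h0, zero_mul] at hππ; exact zero_ne_one hππ
  have hB : π * (x₁ - x₃) ≠ 0 := mul_ne_zero hπ0 (sub_ne_zero.2 hx)
  obtain ⟨h1, h2'⟩ := (mem_centralizer_block_iff_of_ne_zero σ hτ ht hB).1 hτt
  -- `γ = π′² bσb β`, `δ = α + (b − σb) π′ β`
  have hx0 : x₁ - x₃ ≠ 0 := sub_ne_zero.2 hx
  have hγ : γ = π' * π' * (b * σ b) * β := by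
    have : (x₁ - x₃) * γ = (x₁ - x₃) * (π' * π' * (b * σ b) * β) := by
      linear_combination (-π') * h1 - ((x₁ - x₃) * γ) * hππ
    exact mul_left_cancel₀ hx0 this
  have hδ : δ = α + (b - σ b) * π' * β := by
    have : (x₁ - x₃) * (α - δ) = (x₁ - x₃) * (π' * β * (σ b - b)) := by
      linear_combination π' * h2' - ((x₁ - x₃) * (α - δ)) * hππ
    have := mul_left_cancel₀ hx0 this
    linear_combination (-1 : K) * this
  have e1 : (α + b * π' * β) * σ b + (α - σ b * π' * β) * b = α := by linear_combination α * hb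
  have e2 : π * ((α + b * π' * β) - (α - σ b * π' * β)) = β := by linear_combination β * hππ + (π * π' * β) * hb
  have e3 : π' * (b * σ b * ((α + b * π' * β) - (α - σ b * π' * β))) = γ := by rw [hγ]; linear_combination (π' * π' * (b * σ b) * β) * hb
  have e4 : (α + b * π' * β) * b + (α - σ b * π' * β) * σ b = δ := by rw [hδ]; linear_combination (α + (b - σ b) * π' * β) * hb
  refine ⟨α + b * π' * β, e, α - σ b * π' * β, ?_, ?_, ?_, ?_⟩
  · rw [hτ, e1, e2, e3, e4]
  · rw [hτ]; simp
  · rw [hτ]; simp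
  · rw [hτ]; simp

include hJ in
/-- **THE EIGEN-COORDINATES OF A UNITARY TRACE TORUS BLOCK ARE NORM-ONE**: if `M(x,e,y) ∈ U(σ, Φ₃)` then `σx·x = σe·e = σy·y = 1` (`σσ = id`, `σπ = π`, `σπ′ = π′`,
`b + σb = 1`, `ππ′ = 1`): the four corner relations (★ `SplitDictionary.rel_of_coe_eq_block`) say `N^*N = 1` for `N = xP + y(1−P)`, `N^* = σx·P + σy·(1−P)`.
[cite: Flicker1998UnitaryFL, §2 Prop. 3 pp. 78–79; Prop. 6 p. 83] -/
theorem map_mul_self_eq_one_of_coe_eq_traceTorusBlock (hσσ : ∀ z, σ (σ z) = z) {b π π' : K} (hb : b + σ b = 1) (hππ : π * π' = 1)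
    (hσπ : σ π = π) (hσπ' : σ π' = π') {τ : ↥(unitaryGroupOfForm σ J)} {x e y : K}
    (hτ : ((τ : GL (Fin 3) K) : Matrix (Fin 3) (Fin 3) K) =
      !![x * σ b + y * b, 0, π * (x - y); 0, e, 0; π' * (b * σ b * (x - y)), 0, x * b + y * σ b]) :
    σ x * x = 1 ∧ σ e * e = 1 ∧ σ y * y = 1 := by
  have hτ3 : ((τ : GL (Fin 3) K)) ∈ unitaryGroupOfForm σ ((StdForm.antidiagonal 3).over K) := by rw [← hJ]; exact τ.2
  obtain ⟨⟨R1, R2, R3, R4⟩, he⟩ := SplitDictionary.rel_of_coe_eq_block σ hτ3 hτ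
  simp only [map_add, map_sub, map_mul, hσσ, hσπ, hσπ'] at R1 R2 R3 R4
  have hb' : σ b = 1 - b := by linear_combination hb
  rw [hb'] at R3 R4
  refine ⟨?_, he, ?_⟩
  · grind
  · grind

end Literature.NumberTheory.Automorphic.UnitaryGroup

/-! ## §5 Valuations: `|b| = |σb| = 1`; norm-one coordinates are units -/

namespace Literature.NumberTheory.Automorphic.UnitaryGroup

variable {K : Type*} [Field K] [Valued K ℤᵐ⁰] (σ : K →+* K)

/-- **`|b| = 1` AND `|σb| = 1` FROM `b + σb = 1`, `|b| ≤ 1` ALONE** (isometric `σ`), at EVERY residue characteristic: if `|b| < 1` then `σb = 1 − b` is a `1`-unit of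
valuation `|σb| = |b| < 1`, absurd.  (Residually: `b̄ + σ̄b̄ = 1` excludes `b̄ ∈ {0, 1}` since `Tr 1 = 2 ≠ 1`, also in characteristic `2` where `2 = 0`.)  NOT claimed: `|σb − b| = 1`
(false for `b = ½` at `|2| = 1`) — the ring-generator token of CENSUS §0.3 is a separate binder. [cite: Serre1979, Ch. V §2] -/
theorem v_eq_one_of_add_map_eq_one (hσv : ∀ z, Valued.v (σ z) = Valued.v z) {b : K} (hbv : Valued.v b ≤ 1) (hb : b + σ b = 1) :
    Valued.v b = 1 ∧ Valued.v (σ b) = 1 ∧ Valued.v (b * σ b) = 1 := by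
  have key : Valued.v b = 1 := by
    by_contra hne
    have hlt : Valued.v b < 1 := lt_of_le_of_ne hbv hne
    have h1 : Valued.v (σ b) < 1 := by rw [hσv]; exact hlt
    have hσb : σ b = 1 - b := by linear_combination hb
    have h2 : Valued.v (1 - b) = 1 := by
      rw [Valuation.map_one_sub_of_lt _ hlt]
    rw [hσb, h2] at h1
    exact lt_irrefl _ h1
  have key' : Valued.v (σ b) = 1 := by rw [hσv, key]
  exact ⟨key, key', by rw [map_mul, key, key', one_mul]⟩

/-- The eigen-coordinates of a unitary trace torus block are UNITS: `|x| = |e| = |y| = 1` (norm one, ★ (T0) `valued_eq_one_of_map_mul_self_eq_one`).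
[cite: Serre1979, Ch. V §3] -/
theorem v_traceTorusBlock_coord_eq_one (hσv : ∀ z, Valued.v (σ z) = Valued.v z) {x e y : K}
    (h : σ x * x = 1 ∧ σ e * e = 1 ∧ σ y * y = 1) : Valued.v x = 1 ∧ Valued.v e = 1 ∧ Valued.v y = 1 :=
  ⟨Literature.NumberTheory.LocalFields.valued_eq_one_of_map_mul_self_eq_one hσv h.1,
    Literature.NumberTheory.LocalFields.valued_eq_one_of_map_mul_self_eq_one hσv h.2.1,
    Literature.NumberTheory.LocalFields.valued_eq_one_of_map_mul_self_eq_one hσv h.2.2⟩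

end Literature.NumberTheory.Automorphic.UnitaryGroup

/-! ## §6 For F2's typer (Prop. 6 (a) in the trace frame) — the left-normaliser replacing ★'s `diag(θ, 1)` (PAPER, census §6 (i); not used above)

With `d := g − σg` (T1's skew unit, `g` the ring generator) and the dictionary `D₁ = diag(d, 1)` of ★ γ0: the corner `N = xP + y(1−P)` of `τ ∈ T` is
`N = (y∕σz)·K(z)`, `K(z) := z·P + σz·(1−P)` for any `z` with `z∕σz = x∕y`; `z ↦ K(z)` is an `F`-ALGEBRA embedding `E → M₂(E)` (`K(zz′) = K(z)K(z′)`, `P² = P`), entrywise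
`σ(K(z)) = S·K(z)·S` (`S = diag(1,−1)`, because `P^σ = S(1−P)S`), hence `ρ(z) := D₁·K(z)·D₁⁻¹ = σz·1 + (z − σz)·Q ∈ M₂(F)`, `Q := D₁PD₁⁻¹ = (σb, dπ; π′bσb∕d, b)`.
A cyclic vector is `e₁`: `ρ(g)e₁ = (σg + d·σb, π′·bσb)ᵀ`, so with **`C := (1, gσb + bσg; 0, π′·bσb)`** (σ-fixed entries; `det C = π′bσb`, `|det C| = |ϖ|^{−ε}`) one has
`ρ(z)·C = C·ι_g(z)` where `ι_g(u + vg) = (u, −v·gσg; v, u + v(g+σg))` is EXACTLY the regular representation used by ★ γ2b-B `TorusBridge.exists_coords_eq_iota_diag_pow`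
(its `dR := g`).  So in the MARS step apply the ★ bridge to `C⁻¹·G_h` (scaled into the integers) instead of ★'s `diag(θ,1)⁻¹·G_h`; the parity comes out as in ★:
`diag(ϖ^i, ϖ^{−i})·C·diag(1, ϖ^j) = ϖ^i·(1, (gσb + bσg)ϖ^j; 0, π′bσb·ϖ^{j−2i})` is `ϖ^i ×` an element of `GL₂(𝒪_F)` iff `j = 2i + ε` (`|π′| = |ϖ|^{−ε}`, `|bσb| = 1`).
Instances: dyadic `g := b` gives `C = (1, 2bσb; 0, π′bσb)`; tame `g := d₀` skew gives `C = (1, d₀(σb − b); 0, π′bσb)`.  Unchecked in Lean; the typer re-derives. -/
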